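import Summits.CriticalPhenomena.PercolationContinuityZ3.Theorems.PercNearOneGluingNoHeavyQuantDepthOneRelayRow
import Summits.CriticalPhenomena.PercolationContinuityZ3.Theorems.PercNearOneGluingNoHeavyQuantDepthOneRows
import HarnessLib

/-!
# QUANT lane R8, the GRADED-CLOSURE programme: G₀ for EVERY SUB-UNIT PARTNER — the product two-layer row from the
# big factor's depth-1 rows, for an arbitrary second factor of mean `≤ 1`, by an explicit tilt-free tensor certificate

builds on p205010 (kernel theorem, internal audit signed; external expert review pending)

Support file (`--supports stmt-CriticalPhenomena-4575`), QUANT lane seat prim-quant-arm-1 (gen 44, the architect seat, on own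
initiative: the node 'G₀ for a general partner' of census-2 g64's FOR-ARM2-G0-DESIGN was unowned), rung R8 of
`run/shared/lean/prim/quant/LADDER.md`; memo `run/shared/lean/prim/quant/prim-quant-arm-1-g44/G0-SUBUNIT-G44.md`.
Theorems only, standard axioms, no sorries.

THE STATEMENT (`subunitConv_twoLayerRow_of_tlc`).  Floor `0 < y < 1` (ANY floor — light or heavy), `u = y/(1−y)`; a first factor
`μ₁ ≥ 0` on `{0..M₁}` satisfying the depth-1 family `LawDec.TLC y T₁ M₁ μ₁` (all top-low-capacity rows at target `T₁`); a second
factor `μ₂ ≥ 0` on `{0..M₂}` of which ONLY the row `u·μ₂ 0 ≤ Σ_{1 ≤ b ≤ M₂} μ₂ b` is used (its two-layer row `d = 0` at any target in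
`(0, 1]`); a parameter `0 < T₂ ≤ 1` (in the application the mean of `μ₂`: a SUB-UNIT partner — a gated relay at any gate, a gated
small blob, any law of mean `≤ 1`); a product threshold `d` with `2d < T₁`; the product layer `j₀` with `j₀ < T₁ + T₂ − d ≤ j₀ + 1`
(`j₀ + 1 = ⌈T₁ + T₂ − d⌉`) and `j₀ < M₁`; and the HEAVINESS of the one possible hole: if `T₁ − d < j₀` then
`usage y T₁ j₀ d j₀ ≥ 1` (automatic when `T₁ − 2d ≥ 1`: `subunit_hole_heavy_of_one_le_depth`).  CONCLUSION: the two-layer row `d` of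
`lconv M₁ M₂ μ₁ μ₂` at target `T₁ + T₂`:  `u·Σ_{h ≤ d} (μ₁∗μ₂) h ≤ Σ_{h ≤ M₁+M₂, T₁+T₂−d ≤ h} (μ₁∗μ₂) h`.

THE CERTIFICATE (pointwise on `ℕ × ℕ`, `subunit_pointwise`).  With `κ := [T₁ − d < j₀]/usage y T₁ j₀ d j₀ ∈ [0, 1]`: column `b = 0`
carries the factor-1 row `TLC(j₀, d)` (whose only compatible mid is the atom `j₀`, charged `u·κ`); columns `1 ≤ b ≤ d` carry
`(1 − κ)·TLC(j₀ − b, d − b) + κ·TLC(j₀, d − b)` (no compatible mids at all); the atom `a = j₀` carries `κ ×` the partner row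
`u·[b = 0] − [1 ≤ b]`.  Every cell is an identity or a sign: `b = 0` exact (the hole at `(j₀, 0)` is paid by the partner row);
`1 ≤ b ≤ d`: the product giants start at `j₀ − b + 1 ≤ j₀`, so trading `κ` of the giant weight on `[j₀−b+1, j₀]` for the partner
row's `−κ` at `(j₀, b)` loses nothing; `b > d`: only the partner row's `−κ ≥ −1` at the giant cell `(j₀, b)`.  NO tilts, NO mass or
mean hypothesis on either factor, the partner enters through ONE row — exactly the shape of census-2 g64's relay lemma
`relayConv_twoLayerRow_of_tlcRow` (✓ p377094, partner = the TA-tight relay, rows with `T − 2d ≥ 1`) and its shallow companion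
(p377282, `1/2 ≤ T − 2d < 1`), which this file extends from the relay to every sub-unit partner by ONE `μ₂`-uniform certificate.

EVIDENCE (memo §3): the certificate was extracted from exact tensor LPs (arm-1 g44 engine `work/g0/`, pure python, exact simplex)
and verified in exact arithmetic on 73 619 cells (`y ∈ [1/10, 9/10]`, `M₁ ≤ 40`, `M₂ ≤ 9`, `T₂ ≤ 1`, all admissible `d`): 0 failures;
the heaviness hypothesis is exactly the legality of the weight `1 − κ` (the cells with `κ > 1` are the only failures of the formula).
HONEST STATUS: a support lemma for the OPEN node G₀ (`LawDec.TLCGateConvTLB`); the rows `d < min(T₁,T₂)` of that node are floor-free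
consequences of the means alone (`gateConv_row_belowTargets`, ✓ p377822); nothing here changes the lane's RATE class log\* or honest
sentence (`run/shared/lean/prim/quant/README.md`).

[this work]; the relay case and the depth-1 rows: prim-quant-census-2 g63/g64; the tensor-certificate principle: prim-quant-arm-2 g38
(this lane).  Nothing here is cited as a published result.  The gluing rows served [cite: KozmaNitzan2024, Conjecture 3 (p. 15)];
product measure [cite: Grimmett1999, §1.3 p. 10].
-/

noncomputable section

namespace Summit.CriticalPhenomena.PercolationContinuityZ3.Theorems

namespace Quant

open Finset

namespace LawDec

/-! ### The factor-1 row in functional form -/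

/-- **`TLC` in functional form**: the row `(j, i′)` says `Σ_{a ≤ M} μ a · (y / (1 - y) * (if () ≤ i then (1 : ℝ) else 0) - (if j + 1 ≤ () then (1 : ℝ) else 0) - y / (1 - y) * (if () ≤ j ∧ T < ((i : ℕ) : ℝ) + () then 1 / usage y T j i () else 0))′ a ≤ 0`. [this work] -/
theorem tlc_functional {y T : ℝ} {M : ℕ} {μ : ℕ → ℝ} (h : TLC y T M μ) {j i' : ℕ} (hjM : j < M) (hij : i' ≤ j)
    (hlow : 2 * (i' : ℝ) < T) :
    ∑ a ∈ Finset.range (M + 1), μ a * (y / (1 - y) * (if a ≤ i' then (1 : ℝ) else 0) - (if j + 1 ≤ a then (1 : ℝ) else 0) - y / (1 - y) * (if a ≤ j ∧ T < ((i' : ℕ) : ℝ) + a then 1 / usage y T j i' a else 0)) ≤ 0 := by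
  have hrow := h j i' hjM hij hlow
  have hiM : i' + 1 ≤ M + 1 := by omega
  have hlowsum : ∑ l ∈ Finset.range (i' + 1), μ l = ∑ a ∈ Finset.range (M + 1), (if a ≤ i' then μ a else 0) := by
    rw [← Finset.sum_range_add_sum_Ico _ hiM]
    have h1 : ∑ a ∈ Finset.range (i' + 1), (if a ≤ i' then μ a else 0) = ∑ l ∈ Finset.range (i' + 1), μ l :=
      Finset.sum_congr rfl fun a ha => by rw [if_pos (by rw [Finset.mem_range] at ha; omega)]
    have h2 : ∑ a ∈ Finset.Ico (i' + 1) (M + 1), (if a ≤ i' then μ a else 0) = 0 :=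
      Finset.sum_eq_zero fun a ha => by rw [Finset.mem_Ico] at ha; rw [if_neg (by omega)]
    rw [h1, h2, add_zero]
  rw [hlowsum] at hrow
  have e : ∀ a ∈ Finset.range (M + 1), μ a * (y / (1 - y) * (if a ≤ i' then (1 : ℝ) else 0) - (if j + 1 ≤ a then (1 : ℝ) else 0) - y / (1 - y) * (if a ≤ j ∧ T < ((i' : ℕ) : ℝ) + a then 1 / usage y T j i' a else 0))
      = y / (1 - y) * (if a ≤ i' then μ a else 0) - (if j + 1 ≤ a then μ a else 0)
        - y / (1 - y) * (if a ≤ j ∧ T < (i' : ℝ) + a then μ a / usage y T j i' a else 0) := by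
    intro a _
    split_ifs <;> ring
  rw [Finset.sum_congr rfl e, Finset.sum_sub_distrib, Finset.sum_sub_distrib, ← Finset.mul_sum, ← Finset.mul_sum]
  linarith

/-- a row without compatible mids: if `¬(a ≤ j ∧ T < i′ + a)` then `C_{j,i′}(a) = u·[a ≤ i′] − [j+1 ≤ a]`. [this work] -/
theorem tlcCoeff_of_not_mid (y T : ℝ) (j i' a : ℕ) (h : ¬ (a ≤ j ∧ T < (i' : ℝ) + a)) :
    (y / (1 - y) * (if a ≤ i' then (1 : ℝ) else 0) - (if j + 1 ≤ a then (1 : ℝ) else 0) - y / (1 - y) * (if a ≤ j ∧ T < ((i' : ℕ) : ℝ) + a then 1 / usage y T j i' a else 0)) = y / (1 - y) * (if a ≤ i' then (1 : ℝ) else 0) - (if j + 1 ≤ a then (1 : ℝ) else 0) := by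
  rw [if_neg h]; ring

/-! ### The certificate and its pointwise inequality -/

/-- **the pointwise certificate inequality** (all the combinatorics of the file).  Data: `0 < y < 1`, `0 < T₂ ≤ 1`, `2d < T₁`,
`j₀ < T₁ + T₂ − d ≤ j₀ + 1`, a weight `0 ≤ κ ≤ 1` with `κ = 1/usage y T₁ j₀ d j₀` when `T₁ − d < j₀` and `κ = 0` otherwise.
For every cell `(a, b) ∈ ℕ × ℕ` the product coefficient `u·[a+b ≤ d] − [T₁+T₂−d ≤ a+b]` is at most
`[b = 0]·C_{j₀,d}(a) + [1 ≤ b ≤ d]·((1−κ)·C_{j₀−b,d−b}(a) + κ·C_{j₀,d−b}(a)) + [a = j₀]·κ·(u[b = 0] − [1 ≤ b])` (`C_{j,i′}` the coefficient vector of `TLC(j,i′)`, `tlc_functional`).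
[this work] -/
theorem subunit_pointwise (y T₁ T₂ κ : ℝ) (d j₀ a b : ℕ) (hy0 : 0 < y) (hy1 : y < 1) (hT20 : 0 < T₂) (hT21 : T₂ ≤ 1)
    (hlow : 2 * (d : ℝ) < T₁) (hj0 : (j₀ : ℝ) < T₁ + T₂ - d) (hj0' : T₁ + T₂ - d ≤ (j₀ : ℝ) + 1)
    (hκ0 : 0 ≤ κ) (hκ1 : κ ≤ 1)
    (hκh : T₁ - d < (j₀ : ℝ) → κ = 1 / usage y T₁ j₀ d j₀) :
    y / (1 - y) * (if a + b ≤ d then (1 : ℝ) else 0) - (if T₁ + T₂ - d ≤ ((a + b : ℕ) : ℝ) then (1 : ℝ) else 0)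
      ≤ (if b = 0 then (y / (1 - y) * (if a ≤ d then (1 : ℝ) else 0) - (if j₀ + 1 ≤ a then (1 : ℝ) else 0) - y / (1 - y) * (if a ≤ j₀ ∧ T₁ < ((d : ℕ) : ℝ) + a then 1 / usage y T₁ j₀ d a else 0)) else 0)
        + (if 1 ≤ b ∧ b ≤ d then (1 - κ) * (y / (1 - y) * (if a ≤ (d - b) then (1 : ℝ) else 0) - (if (j₀ - b) + 1 ≤ a then (1 : ℝ) else 0) - y / (1 - y) * (if a ≤ (j₀ - b) ∧ T₁ < ((d - b : ℕ) : ℝ) + a then 1 / usage y T₁ (j₀ - b) (d - b) a else 0)) + κ * (y / (1 - y) * (if a ≤ (d - b) then (1 : ℝ) else 0) - (if j₀ + 1 ≤ a then (1 : ℝ) else 0) - y / (1 - y) * (if a ≤ j₀ ∧ T₁ < ((d - b : ℕ) : ℝ) + a then 1 / usage y T₁ j₀ (d - b) a else 0)) else 0)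
        + (if a = j₀ then κ * (y / (1 - y) * (if b = 0 then (1 : ℝ) else 0) - (if 1 ≤ b then (1 : ℝ) else 0)) else 0) := by
  have h1y : 0 < 1 - y := by linarith
  have hu0 : 0 < y / (1 - y) := div_pos hy0 h1y
  have hdj : d ≤ j₀ := by
    have : (d : ℝ) < j₀ + 1 := by linarith
    have : d < j₀ + 1 := by exact_mod_cast this
    omega
  -- the product giant threshold: [T - d ≤ n] ⟺ [j₀ + 1 ≤ n]
  have hgiant : ∀ n : ℕ, (T₁ + T₂ - d ≤ (n : ℝ)) ↔ j₀ + 1 ≤ n := by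
    intro n; constructor
    · intro h
      have : (j₀ : ℝ) < n := by linarith
      have : j₀ < n := by exact_mod_cast this
      omega
    · exact fun h => le_trans hj0' (by exact_mod_cast h)
  have hG : (if T₁ + T₂ - d ≤ ((a + b : ℕ) : ℝ) then (1 : ℝ) else 0) = (if j₀ + 1 ≤ a + b then (1 : ℝ) else 0) := by
    by_cases h : j₀ + 1 ≤ a + b
    · rw [if_pos ((hgiant _).2 h), if_pos h]
    · rw [if_neg (fun h' => h ((hgiant _).1 h')), if_neg h]
  rw [hG]
  -- T₁ - d > j₀ - 1 (since T₂ ≤ 1)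
  have hTd : (j₀ : ℝ) - 1 < T₁ - d := by linarith
  rcases Nat.eq_zero_or_pos b with hb0 | hbpos
  · ----------------------------------------------------------------- column b = 0
    subst hb0
    have e0 : ∀ (x z : ℝ), (if (0 : ℕ) = 0 then x else z) = x := fun x z => if_pos rfl
    have e1 : ∀ (x z : ℝ), (if 1 ≤ (0 : ℕ) ∧ (0 : ℕ) ≤ d then x else z) = z := fun x z => if_neg (by omega)
    have e2 : ∀ (x z : ℝ), (if 1 ≤ (0 : ℕ) then x else z) = z := fun x z => if_neg (by omega)
    rw [Nat.add_zero, e0, e1, e0, e2, add_zero, mul_one, sub_zero]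
    -- goal: u[a ≤ d] - [j₀+1 ≤ a] ≤ (y / (1 - y) * (if a ≤ d then (1 : ℝ) else 0) - (if j₀ + 1 ≤ a then (1 : ℝ) else 0) - y / (1 - y) * (if a ≤ j₀ ∧ T₁ < ((d : ℕ) : ℝ) + a then 1 / usage y T₁ j₀ d a else 0)) + (if a = j₀ then κ * u else 0)
    by_cases hmid : a ≤ j₀ ∧ T₁ < (d : ℝ) + a
    · -- the only compatible mid is a = j₀, and then the hole is priced exactly
      have haj : a = j₀ := by
        have h1 : (j₀ : ℝ) - 1 < a := by linarith [hmid.2]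
        have h2 : j₀ < a + 1 := by
          have : (j₀ : ℝ) < a + 1 := by linarith
          exact_mod_cast this
        omega
      have hhole : T₁ - d < (j₀ : ℝ) := by
        have := hmid.2; rw [haj] at this; linarith
      have hκ := hκh hhole
      rw [if_pos haj]
      rw [if_pos hmid, haj, hκ]
      apply le_of_eq
      ring
    · rw [tlcCoeff_of_not_mid y T₁ j₀ d a hmid]
      have hlast : 0 ≤ (if a = j₀ then κ * (y / (1 - y)) else 0) := by
        split_ifs
        exacts [mul_nonneg hκ0 hu0.le, le_rfl]
      linarith
  · by_cases hbd : b ≤ d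
    · --------------------------------------------------------------- columns 1 ≤ b ≤ d
      have hb1 : 1 ≤ b := hbpos
      rw [if_neg (show b ≠ 0 by omega), zero_add, if_pos (show 1 ≤ b ∧ b ≤ d from ⟨hb1, hbd⟩),
        if_neg (show b ≠ 0 by omega), if_pos hb1]
      -- no compatible mids in either factor-1 row
      have hcast : ((d - b : ℕ) : ℝ) = (d : ℝ) - b := by rw [Nat.cast_sub hbd]
      have hb1r : (1 : ℝ) ≤ b := by exact_mod_cast hb1
      have hnm1 : ¬ (a ≤ j₀ - b ∧ T₁ < ((d - b : ℕ) : ℝ) + a) := by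
        rintro ⟨h1, h2⟩
        rw [hcast] at h2
        have : (j₀ : ℝ) < a := by linarith
        have : j₀ < a := by exact_mod_cast this
        omega
      have hnm2 : ¬ (a ≤ j₀ ∧ T₁ < ((d - b : ℕ) : ℝ) + a) := by
        rintro ⟨h1, h2⟩
        rw [hcast] at h2
        have : (j₀ : ℝ) < a := by linarith
        have : j₀ < a := by exact_mod_cast this
        omega
      rw [tlcCoeff_of_not_mid y T₁ (j₀ - b) (d - b) a hnm1, tlcCoeff_of_not_mid y T₁ j₀ (d - b) a hnm2]
      -- indicator bookkeeping
      have e1 : (if a + b ≤ d then (1 : ℝ) else 0) = (if a ≤ d - b then (1 : ℝ) else 0) := by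
        by_cases h : a + b ≤ d
        · rw [if_pos h, if_pos (by omega)]
        · rw [if_neg h, if_neg (by omega)]
      have e2 : (if j₀ + 1 ≤ a + b then (1 : ℝ) else 0) = (if j₀ - b + 1 ≤ a then (1 : ℝ) else 0) := by
        by_cases h : j₀ + 1 ≤ a + b
        · rw [if_pos h, if_pos (by omega)]
        · rw [if_neg h, if_neg (by omega)]
      rw [e1, e2]
      -- the remaining indicators: [j₀+1 ≤ a] + [a = j₀] ≤ [j₀-b+1 ≤ a]
      have hGG : (if j₀ + 1 ≤ a then (1 : ℝ) else 0) + (if a = j₀ then (1 : ℝ) else 0)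
          ≤ (if j₀ - b + 1 ≤ a then (1 : ℝ) else 0) := by
        by_cases h1 : j₀ + 1 ≤ a
        · rw [if_pos h1, if_neg (by omega), if_pos (by omega)]; norm_num
        · rw [if_neg h1]
          by_cases h2 : a = j₀
          · rw [if_pos h2, if_pos (by omega)]; norm_num
          · rw [if_neg h2, zero_add]; split_ifs <;> norm_num
      have hI0 : 0 ≤ (if j₀ - b + 1 ≤ a then (1 : ℝ) else 0) := by split_ifs <;> norm_num
      have hI1 : (if j₀ - b + 1 ≤ a then (1 : ℝ) else 0) ≤ 1 := by split_ifs <;> norm_num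
      have hk : (if a = j₀ then κ * (y / (1 - y) * 0 - 1) else 0) = -κ * (if a = j₀ then (1 : ℝ) else 0) := by
        split_ifs <;> ring
      rw [hk]
      have hU0 : 0 ≤ y / (1 - y) * (if a ≤ d - b then (1 : ℝ) else 0) := by
        refine mul_nonneg hu0.le ?_; split_ifs <;> norm_num
      nlinarith [hGG, hI0, hI1, hκ0, hκ1, mul_nonneg hκ0 (sub_nonneg.2 hGG)]
    · --------------------------------------------------------------- columns b > d
      have hb1 : 1 ≤ b := hbpos
      rw [if_neg (show b ≠ 0 by omega), zero_add, if_neg (show ¬ (1 ≤ b ∧ b ≤ d) by omega), zero_add,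
        if_neg (show ¬ (a + b ≤ d) by omega), mul_zero, zero_sub, if_neg (show b ≠ 0 by omega), if_pos hb1,
        mul_zero, zero_sub]
      by_cases haj : a = j₀
      · rw [if_pos haj, if_pos (show j₀ + 1 ≤ a + b by omega)]; linarith
      · rw [if_neg haj]; split_ifs <;> linarith

/-! ### The theorem -/

/-- the heaviness hypothesis is automatic one unit below the top low: `T₁ − 2d ≥ 1`, `T₁ − d < j₀ < T₁ + T₂ − d`, `T₂ ≤ 1`
⟹ `usage y T₁ j₀ d j₀ ≥ 1` (the heavy rate `(T₁−2d)/(d+j₀−T₁)` already exceeds `1`). [this work] -/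
theorem subunit_hole_heavy_of_one_le_depth (y T₁ T₂ : ℝ) (d j₀ : ℕ) (hy0 : 0 < y) (hy1 : y < 1) (hT21 : T₂ ≤ 1)
    (hlow : 2 * (d : ℝ) < T₁) (hj0 : (j₀ : ℝ) < T₁ + T₂ - d) (hs : 1 ≤ T₁ - 2 * (d : ℝ)) (hhole : T₁ - d < (j₀ : ℝ)) :
    1 ≤ usage y T₁ j₀ d j₀ := by
  have hcomp : T₁ < (d : ℝ) + j₀ := by linarith
  refine le_trans ?_ (heavy_le_usage y T₁ j₀ d j₀ hy0 hy1 le_rfl hlow hcomp)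
  rw [le_div_iff₀ (by linarith)]
  linarith

/-- **G₀ FOR EVERY SUB-UNIT PARTNER (q = 1, any floor).**  See the file header: from the depth-1 family `TLC y T₁ M₁ μ₁` of the first
factor and the single partner row `u·μ₂ 0 ≤ Σ_{1 ≤ b ≤ M₂} μ₂ b`, the two-layer row `d` of `lconv M₁ M₂ μ₁ μ₂` at target `T₁ + T₂`,
for every `0 < T₂ ≤ 1`, `2d < T₁`, product layer `j₀` (`j₀ < T₁+T₂−d ≤ j₀+1`, `j₀ < M₁`) whose possible hole is heavy
(`T₁ − d < j₀ → 1 ≤ usage y T₁ j₀ d j₀`).  No mass, mean or top-affordability hypothesis on either factor. [this work] -/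
theorem subunitConv_twoLayerRow_of_tlc (y T₁ T₂ : ℝ) (M₁ M₂ d j₀ : ℕ) (μ₁ μ₂ : ℕ → ℝ)
    (hy0 : 0 < y) (hy1 : y < 1) (h10 : ∀ a, 0 ≤ μ₁ a) (h20 : ∀ b, 0 ≤ μ₂ b)
    (hT20 : 0 < T₂) (hT21 : T₂ ≤ 1) (hlow : 2 * (d : ℝ) < T₁)
    (hj0 : (j₀ : ℝ) < T₁ + T₂ - d) (hj0' : T₁ + T₂ - d ≤ (j₀ : ℝ) + 1) (hj0M : j₀ < M₁)
    (hTLC : TLC y T₁ M₁ μ₁)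
    (hTLB2 : y / (1 - y) * μ₂ 0 ≤ ∑ b ∈ Finset.range (M₂ + 1), (if 1 ≤ b then μ₂ b else 0))
    (hheavy : T₁ - d < (j₀ : ℝ) → 1 ≤ usage y T₁ j₀ d j₀) :
    y / (1 - y) * ∑ h ∈ Finset.range (d + 1), lconv M₁ M₂ μ₁ μ₂ h
      ≤ ∑ h ∈ Finset.range (M₁ + M₂ + 1), (if T₁ + T₂ - d ≤ (h : ℝ) then lconv M₁ M₂ μ₁ μ₂ h else 0) := by
  classical
  have h1y : 0 < 1 - y := by linarith
  have hu0 : 0 < y / (1 - y) := div_pos hy0 h1y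
  have hdj : d ≤ j₀ := by
    have : (d : ℝ) < j₀ + 1 := by linarith
    have : d < j₀ + 1 := by exact_mod_cast this
    omega
  have hdM : d + 1 ≤ M₁ + M₂ + 1 := by omega
  -- the weight κ
  set κ : ℝ := if T₁ - d < (j₀ : ℝ) then 1 / usage y T₁ j₀ d j₀ else 0 with hκdef
  have hκh : T₁ - d < (j₀ : ℝ) → κ = 1 / usage y T₁ j₀ d j₀ := fun h => by rw [hκdef, if_pos h]
  have hκ0 : 0 ≤ κ := by
    rw [hκdef]; split_ifs with h
    · exact div_nonneg zero_le_one (le_trans zero_le_one (hheavy h))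
    · exact le_rfl
  have hκ1 : κ ≤ 1 := by
    rw [hκdef]; split_ifs with h
    · rw [div_le_one (lt_of_lt_of_le zero_lt_one (hheavy h))]; exact hheavy h
    · exact zero_le_one
  -- a test function against the convolution (the identity `LawDec.sum_fun_mul_lconv` of arm-2 g38, re-derived inline)
  have hconv : ∀ φ : ℕ → ℝ, ∑ h ∈ Finset.range (M₁ + M₂ + 1), φ h * lconv M₁ M₂ μ₁ μ₂ h
      = ∑ a ∈ Finset.range (M₁ + 1), ∑ s ∈ Finset.range (M₂ + 1), φ (a + s) * (μ₁ a * μ₂ s) := by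
    intro φ
    simp only [lconv, Finset.mul_sum]
    rw [Finset.sum_comm]
    refine Finset.sum_congr rfl fun a ha => ?_
    rw [Finset.sum_comm]
    refine Finset.sum_congr rfl fun s hs => ?_
    rw [Finset.mem_range] at ha hs
    have e : ∀ h : ℕ, φ h * (if a + s = h then μ₁ a * μ₂ s else 0) = if a + s = h then φ (a + s) * (μ₁ a * μ₂ s) else 0 := by
      intro h
      split_ifs with hh
      · rw [hh]
      · rw [mul_zero]
    simp_rw [e]
    rw [Finset.sum_ite_eq (Finset.range (M₁ + M₂ + 1)) (a + s), if_pos (Finset.mem_range.2 (by omega))]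
  -- (1) both sides as test functions against the convolution
  set ν := lconv M₁ M₂ μ₁ μ₂ with hν
  have hL : ∑ h ∈ Finset.range (d + 1), ν h = ∑ h ∈ Finset.range (M₁ + M₂ + 1), (if h ≤ d then (1 : ℝ) else 0) * ν h := by
    rw [← Finset.sum_range_add_sum_Ico _ hdM]
    have e1 : ∑ h ∈ Finset.range (d + 1), (if h ≤ d then (1 : ℝ) else 0) * ν h = ∑ h ∈ Finset.range (d + 1), ν h :=
      Finset.sum_congr rfl fun h hh => by rw [if_pos (by rw [Finset.mem_range] at hh; omega), one_mul]
    have e2 : ∑ h ∈ Finset.Ico (d + 1) (M₁ + M₂ + 1), (if h ≤ d then (1 : ℝ) else 0) * ν h = 0 :=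
      Finset.sum_eq_zero fun h hh => by rw [Finset.mem_Ico] at hh; rw [if_neg (by omega), zero_mul]
    rw [e1, e2, add_zero]
  have hR : ∑ h ∈ Finset.range (M₁ + M₂ + 1), (if T₁ + T₂ - d ≤ (h : ℝ) then ν h else 0)
      = ∑ h ∈ Finset.range (M₁ + M₂ + 1), (if T₁ + T₂ - d ≤ (h : ℝ) then (1 : ℝ) else 0) * ν h :=
    Finset.sum_congr rfl fun h _ => by split_ifs <;> simp
  rw [hL, hR, Finset.mul_sum]
  -- combine into one test function K
  have hK : ∑ h ∈ Finset.range (M₁ + M₂ + 1), y / (1 - y) * ((if h ≤ d then (1 : ℝ) else 0) * ν h)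
        - ∑ h ∈ Finset.range (M₁ + M₂ + 1), (if T₁ + T₂ - d ≤ (h : ℝ) then (1 : ℝ) else 0) * ν h
      = ∑ h ∈ Finset.range (M₁ + M₂ + 1),
          (y / (1 - y) * (if h ≤ d then (1 : ℝ) else 0) - (if T₁ + T₂ - d ≤ (h : ℝ) then (1 : ℝ) else 0)) * ν h := by
    rw [← Finset.sum_sub_distrib]
    exact Finset.sum_congr rfl fun h _ => by ring
  rw [← sub_nonpos, hK, hν, hconv]
  -- (2) the pointwise certificate, cell by cell
  have hcell : ∀ a ∈ Finset.range (M₁ + 1), ∀ b ∈ Finset.range (M₂ + 1),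
      (y / (1 - y) * (if a + b ≤ d then (1 : ℝ) else 0) - (if T₁ + T₂ - d ≤ ((a + b : ℕ) : ℝ) then (1 : ℝ) else 0)) * (μ₁ a * μ₂ b)
        ≤ μ₂ b * ((if b = 0 then (y / (1 - y) * (if a ≤ d then (1 : ℝ) else 0) - (if j₀ + 1 ≤ a then (1 : ℝ) else 0) - y / (1 - y) * (if a ≤ j₀ ∧ T₁ < ((d : ℕ) : ℝ) + a then 1 / usage y T₁ j₀ d a else 0)) else 0) * μ₁ a)
          + μ₂ b * ((if 1 ≤ b ∧ b ≤ d then (1 - κ) * (y / (1 - y) * (if a ≤ (d - b) then (1 : ℝ) else 0) - (if (j₀ - b) + 1 ≤ a then (1 : ℝ) else 0) - y / (1 - y) * (if a ≤ (j₀ - b) ∧ T₁ < ((d - b : ℕ) : ℝ) + a then 1 / usage y T₁ (j₀ - b) (d - b) a else 0)) + κ * (y / (1 - y) * (if a ≤ (d - b) then (1 : ℝ) else 0) - (if j₀ + 1 ≤ a then (1 : ℝ) else 0) - y / (1 - y) * (if a ≤ j₀ ∧ T₁ < ((d - b : ℕ) : ℝ) + a then 1 / usage y T₁ j₀ (d -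 b) a else 0)) else 0) * μ₁ a)
          + (κ * (if a = j₀ then μ₁ a else 0))
              * ((y / (1 - y) * (if b = 0 then (1 : ℝ) else 0) - (if 1 ≤ b then (1 : ℝ) else 0)) * μ₂ b) := by
    intro a _ b _
    have hp := subunit_pointwise y T₁ T₂ κ d j₀ a b hy0 hy1 hT20 hT21 hlow hj0 hj0' hκ0 hκ1 hκh
    have hw : 0 ≤ μ₁ a * μ₂ b := mul_nonneg (h10 a) (h20 b)
    have := mul_le_mul_of_nonneg_right hp hw
    have e : ((if b = 0 then (y / (1 - y) * (if a ≤ d then (1 : ℝ) else 0) - (if j₀ + 1 ≤ a then (1 : ℝ) else 0) - y / (1 - y) * (if a ≤ j₀ ∧ T₁ < ((d : ℕ) : ℝ) + a then 1 / usage y T₁ j₀ d a else 0)) else 0)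
        + (if 1 ≤ b ∧ b ≤ d then (1 - κ) * (y / (1 - y) * (if a ≤ (d - b) then (1 : ℝ) else 0) - (if (j₀ - b) + 1 ≤ a then (1 : ℝ) else 0) - y / (1 - y) * (if a ≤ (j₀ - b) ∧ T₁ < ((d - b : ℕ) : ℝ) + a then 1 / usage y T₁ (j₀ - b) (d - b) a else 0)) + κ * (y / (1 - y) * (if a ≤ (d - b) then (1 : ℝ) else 0) - (if j₀ + 1 ≤ a then (1 : ℝ) else 0) - y / (1 - y) * (if a ≤ j₀ ∧ T₁ < ((d - b : ℕ) : ℝ) + a then 1 / usage y T₁ j₀ (d - b) a else 0)) else 0)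
        + (if a = j₀ then κ * (y / (1 - y) * (if b = 0 then (1 : ℝ) else 0) - (if 1 ≤ b then (1 : ℝ) else 0)) else 0)) * (μ₁ a * μ₂ b)
        = μ₂ b * ((if b = 0 then (y / (1 - y) * (if a ≤ d then (1 : ℝ) else 0) - (if j₀ + 1 ≤ a then (1 : ℝ) else 0) - y / (1 - y) * (if a ≤ j₀ ∧ T₁ < ((d : ℕ) : ℝ) + a then 1 / usage y T₁ j₀ d a else 0)) else 0) * μ₁ a)
          + μ₂ b * ((if 1 ≤ b ∧ b ≤ d then (1 - κ) * (y / (1 - y) * (if a ≤ (d - b) then (1 : ℝ) else 0) - (if (j₀ - b) + 1 ≤ a then (1 : ℝ) else 0) - y / (1 - y) * (if a ≤ (j₀ - b) ∧ T₁ < ((d - b : ℕ) : ℝ) + a then 1 / usage y T₁ (j₀ - b) (d - b) a else 0)) + κ * (y / (1 - y) * (if a ≤ (d - b) then (1 : ℝ) else 0) - (if j₀ + 1 ≤ a then (1 : ℝ) else 0) - y / (1 - y) * (if a ≤ j₀ ∧ T₁ < ((d - b : ℕ) : ℝ) + a then 1 / usage y T₁ j₀ (d - b) a else 0)) else 0)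 * μ₁ a)
          + (κ * (if a = j₀ then μ₁ a else 0))
              * ((y / (1 - y) * (if b = 0 then (1 : ℝ) else 0) - (if 1 ≤ b then (1 : ℝ) else 0)) * μ₂ b) := by
      by_cases haj : a = j₀
      · rw [if_pos haj, if_pos haj]; ring
      · rw [if_neg haj, if_neg haj]; ring
    linarith [this, e]
  refine le_trans (Finset.sum_le_sum fun a ha => Finset.sum_le_sum fun b hb => hcell a ha b hb) ?_
  rw [show (∑ a ∈ Finset.range (M₁ + 1), ∑ b ∈ Finset.range (M₂ + 1),
      (μ₂ b * ((if b = 0 then (y / (1 - y) * (if a ≤ d then (1 : ℝ) else 0) - (if j₀ + 1 ≤ a then (1 : ℝ) else 0) - y / (1 - y) * (if a ≤ j₀ ∧ T₁ < ((d : ℕ) : ℝ) + a then 1 / usage y T₁ j₀ d a else 0)) else 0) * μ₁ a)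
        + μ₂ b * ((if 1 ≤ b ∧ b ≤ d then (1 - κ) * (y / (1 - y) * (if a ≤ (d - b) then (1 : ℝ) else 0) - (if (j₀ - b) + 1 ≤ a then (1 : ℝ) else 0) - y / (1 - y) * (if a ≤ (j₀ - b) ∧ T₁ < ((d - b : ℕ) : ℝ) + a then 1 / usage y T₁ (j₀ - b) (d - b) a else 0)) + κ * (y / (1 - y) * (if a ≤ (d - b) then (1 : ℝ) else 0) - (if j₀ + 1 ≤ a then (1 : ℝ) else 0) - y / (1 - y) * (if a ≤ j₀ ∧ T₁ < ((d - b : ℕ) : ℝ) + a then 1 / usage y T₁ j₀ (d - b) a else 0)) else 0) * μ₁ a)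
        + (κ * (if a = j₀ then μ₁ a else 0))
            * ((y / (1 - y) * (if b = 0 then (1 : ℝ) else 0) - (if 1 ≤ b then (1 : ℝ) else 0)) * μ₂ b)))
    = (∑ b ∈ Finset.range (M₂ + 1), μ₂ b * ((if b = 0 then (1 : ℝ) else 0)
          * ∑ a ∈ Finset.range (M₁ + 1), μ₁ a * (y / (1 - y) * (if a ≤ d then (1 : ℝ) else 0) - (if j₀ + 1 ≤ a then (1 : ℝ) else 0) - y / (1 - y) * (if a ≤ j₀ ∧ T₁ < ((d : ℕ) : ℝ) + a then 1 / usage y T₁ j₀ d a else 0))))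
      + (∑ b ∈ Finset.range (M₂ + 1), μ₂ b * (if 1 ≤ b ∧ b ≤ d then
          (1 - κ) * ∑ a ∈ Finset.range (M₁ + 1), μ₁ a * (y / (1 - y) * (if a ≤ (d - b) then (1 : ℝ) else 0) - (if (j₀ - b) + 1 ≤ a then (1 : ℝ) else 0) - y / (1 - y) * (if a ≤ (j₀ - b) ∧ T₁ < ((d - b : ℕ) : ℝ) + a then 1 / usage y T₁ (j₀ - b) (d - b) a else 0))
            + κ * ∑ a ∈ Finset.range (M₁ + 1), μ₁ a * (y / (1 - y) * (if a ≤ (d - b) then (1 : ℝ) else 0) - (if j₀ + 1 ≤ a then (1 : ℝ) else 0) - y / (1 - y) * (if a ≤ j₀ ∧ T₁ < ((d - b : ℕ) : ℝ) + a then 1 / usage y T₁ j₀ (d - b) a else 0)) else 0))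
      + (κ * ∑ a ∈ Finset.range (M₁ + 1), (if a = j₀ then μ₁ a else 0))
          * ∑ b ∈ Finset.range (M₂ + 1), (y / (1 - y) * (if b = 0 then (1 : ℝ) else 0) - (if 1 ≤ b then (1 : ℝ) else 0)) * μ₂ b from ?_]
  · -- (3) each of the three aggregated pieces is ≤ 0
    have hA : ∑ b ∈ Finset.range (M₂ + 1), μ₂ b * ((if b = 0 then (1 : ℝ) else 0)
          * ∑ a ∈ Finset.range (M₁ + 1), μ₁ a * (y / (1 - y) * (if a ≤ d then (1 : ℝ) else 0) - (if j₀ + 1 ≤ a then (1 : ℝ) else 0) - y / (1 - y) * (if a ≤ j₀ ∧ T₁ < ((d : ℕ) : ℝ) + a then 1 / usage y T₁ j₀ d a else 0))) ≤ 0 := by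
      refine Finset.sum_nonpos fun b _ => ?_
      split_ifs
      · rw [one_mul]
        exact mul_nonpos_of_nonneg_of_nonpos (h20 b) (tlc_functional hTLC hj0M hdj hlow)
      · rw [zero_mul, mul_zero]
    have hB : ∑ b ∈ Finset.range (M₂ + 1), μ₂ b * (if 1 ≤ b ∧ b ≤ d then
          (1 - κ) * ∑ a ∈ Finset.range (M₁ + 1), μ₁ a * (y / (1 - y) * (if a ≤ (d - b) then (1 : ℝ) else 0) - (if (j₀ - b) + 1 ≤ a then (1 : ℝ) else 0) - y / (1 - y) * (if a ≤ (j₀ - b) ∧ T₁ < ((d - b : ℕ) : ℝ) + a then 1 / usage y T₁ (j₀ - b) (d - b) a else 0))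
            + κ * ∑ a ∈ Finset.range (M₁ + 1), μ₁ a * (y / (1 - y) * (if a ≤ (d - b) then (1 : ℝ) else 0) - (if j₀ + 1 ≤ a then (1 : ℝ) else 0) - y / (1 - y) * (if a ≤ j₀ ∧ T₁ < ((d - b : ℕ) : ℝ) + a then 1 / usage y T₁ j₀ (d - b) a else 0)) else 0) ≤ 0 := by
      refine Finset.sum_nonpos fun b _ => ?_
      split_ifs with hb
      · have hcast : ((d - b : ℕ) : ℝ) = (d : ℝ) - b := by rw [Nat.cast_sub hb.2]
        have hb0 : (0 : ℝ) ≤ b := Nat.cast_nonneg b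
        have hlow' : 2 * ((d - b : ℕ) : ℝ) < T₁ := by rw [hcast]; linarith
        have h1 := tlc_functional hTLC (show j₀ - b < M₁ by omega) (show d - b ≤ j₀ - b by omega) hlow'
        have h2 := tlc_functional hTLC hj0M (show d - b ≤ j₀ by omega) hlow'
        have hk' : 0 ≤ 1 - κ := by linarith
        exact mul_nonpos_of_nonneg_of_nonpos (h20 b) (by nlinarith)
      · rw [mul_zero]
    have hC : (κ * ∑ a ∈ Finset.range (M₁ + 1), (if a = j₀ then μ₁ a else 0))
          * ∑ b ∈ Finset.range (M₂ + 1), (y / (1 - y) * (if b = 0 then (1 : ℝ) else 0) - (if 1 ≤ b then (1 : ℝ) else 0)) * μ₂ b ≤ 0 := by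
      have hw : 0 ≤ κ * ∑ a ∈ Finset.range (M₁ + 1), (if a = j₀ then μ₁ a else 0) := by
        refine mul_nonneg hκ0 (Finset.sum_nonneg fun a _ => ?_)
        split_ifs
        exacts [h10 a, le_rfl]
      have hS : ∑ b ∈ Finset.range (M₂ + 1), (y / (1 - y) * (if b = 0 then (1 : ℝ) else 0) - (if 1 ≤ b then (1 : ℝ) else 0)) * μ₂ b ≤ 0 := by
        have e : ∀ b ∈ Finset.range (M₂ + 1), (y / (1 - y) * (if b = 0 then (1 : ℝ) else 0) - (if 1 ≤ b then (1 : ℝ) else 0)) * μ₂ b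
            = y / (1 - y) * (if b = 0 then μ₂ b else 0) - (if 1 ≤ b then μ₂ b else 0) := by
          intro b _; split_ifs <;> ring
        rw [Finset.sum_congr rfl e, Finset.sum_sub_distrib, ← Finset.mul_sum, Finset.sum_ite_eq' (Finset.range (M₂ + 1)) 0,
          if_pos (Finset.mem_range.2 (Nat.succ_pos M₂))]
        linarith
      exact mul_nonpos_of_nonneg_of_nonpos hw hS
    linarith
  · -- the rearrangement identity
    simp_rw [Finset.sum_add_distrib]
    congr 1
    · congr 1
      · rw [Finset.sum_comm]
        refine Finset.sum_congr rfl fun b _ => ?_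
        rw [Finset.mul_sum, Finset.mul_sum]
        refine Finset.sum_congr rfl fun a _ => ?_
        by_cases hb : b = 0
        · rw [if_pos hb, if_pos hb]; ring
        · rw [if_neg hb, if_neg hb]; ring
      · rw [Finset.sum_comm]
        refine Finset.sum_congr rfl fun b _ => ?_
        by_cases hP : 1 ≤ b ∧ b ≤ d
        · simp only [if_pos hP]
          rw [Finset.mul_sum, Finset.mul_sum, ← Finset.sum_add_distrib, Finset.mul_sum]
          exact Finset.sum_congr rfl fun a _ => by ring
        · simp only [if_neg hP]
          rw [mul_zero]
          exact Finset.sum_eq_zero fun a _ => by ring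
    · rw [← Finset.sum_mul_sum, ← Finset.mul_sum]

end LawDec

end Quant

end Summit.CriticalPhenomena.PercolationContinuityZ3.Theorems
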